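import Summits.Ventures.DiscreteObjects.Hadamard.InvolutionDet
import Summits.Ventures.DiscreteObjects.Hadamard.Hadamard4qOrder2qNega
import Summits.Ventures.DiscreteObjects.Hadamard.GramTwoSquares

/-!
# Hadamard 668 census, family F12 — type-I involutions have `f ≡ 4 (mod 8)` (the two-squares refinement, kernel)

Framing: lottery ticket; floor = certified bounds/negative ranges.

Cell pub-namedobj (venture DiscreteObjects), target (H), hadamard gen 13; HANDOFF-H-g12 open item 3.  Companion of
`InvolutionDet` (gen 12: `4 ∣ n − f` by the determinant) and `GramTwoSquares` (gen 13: `M Mᵀ = N·1` on `4q + 2` coordinates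
forces `N = x² + y²`, elementary kernel proof of the Raghavarao / Geramita–Seberry condition).

Let `H` be a Hadamard matrix of order `n` with a signed involution `(π, κ, d, e)` of TYPE I (a fixed row and a fixed column) and
`f` fixed rows; the `t × t` folding matrix `B` of `InvolutionDet` (`t = (n − f)/2`, entries `0, ±2`; `B/2` is a weighing matrix
`W(t, n/4)`) has `B Bᵀ = n·I` (`invRep_matrix_mul_transpose`, packaging gen 12's `invRep_row_orth`).  Hence:
* `involution_typeI_eight_dvd` — if `n` is NOT a sum of two squares then `8 ∣ n − f` (`t` even by the determinant, and
  `t ≢ 2 (mod 4)` by `nat_sq_add_sq_of_int_mul_transpose_self`);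
* `hadamard4q_involution_typeI_mod8` — UNIFORM: `n = 4q`, `q ≡ 3 (mod 4)` (so `n` is not a sum of two squares,
  `not_sum_two_sq_four_mul`): every type-I involution has `f ≡ 4 (mod 8)` — applies to the open orders `668, 716, 892`;
* `hadamard668_involution_typeI_mod8` — `H(668)`: `f ≡ 4 (mod 8)`, `4 ≤ f ≤ 332`, `f = #Fix κ`: `f ∈ {4, 12, 20, …, 332}`
  (42 values; gen 12 had the 83 multiples of 4 in `[4, 332]`);
* `hadamard668_involution_census_mod8` — the involution census of `InvolutionCensus668` with this refinement in type I.
Consequence recorded in FAMILY-F12-G13: the `p = 83` survivor `f = 168` of FAMILY-F12-G12 §2 (an involution commuting with an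
order-83 element, `168 = 2 + 2·83`, equivalently a `W(250, 167)`) is dead; for `g` of order `166` the involution `g^83` has
`f ∈ {4, 332}` in type I.  No even order is excluded by this alone.  Ours; classical content (Raghavarao 1960 /
Geramita–Seberry 1979 condition, here with an elementary proof); no `sorry`.
-/

namespace Summit.Ventures.DiscreteObjects.Hadamard

open Finset BigOperators Matrix

open Literature.Combinatorics.Designs.GoethalsSeidel (IsHadamardMatrix)

variable {ι : Type*} [Fintype ι] [DecidableEq ι]

section weighing
variable [LinearOrder ι] {H : Matrix ι ι ℤ} {π κ : Equiv.Perm ι} {d e : ι → ℤ}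

/-- **The folding matrix of a type-I involution**: there is an integer `t × t` matrix `M` with `2t = #moved rows` and
`M Mᵀ = n·1` (a reindexing of `B k j = H k j − δ e j H k (κ j)` on row representatives `k < π k` and column representatives
`j < κ j`) — packaging of gen 12's `invRep_row_orth`. -/
theorem invRep_matrix_mul_transpose (hH : IsHadamardMatrix H) (haut : IsSignedAut H π κ d e)
    (hπinv : ∀ i, π (π i) = i) (hκinv : ∀ j, κ (κ j) = j) {r₀ c₀ : ι} (hr₀ : π r₀ = r₀) (hc₀ : κ c₀ = c₀) :
    ∃ (t : ℕ) (M : Matrix (Fin t) (Fin t) ℤ),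
      2 * t = (univ.filter fun i => π i ≠ i).card ∧ M * Mᵀ = (Fintype.card ι : ℤ) • (1 : Matrix (Fin t) (Fin t) ℤ) := by
  have hcard : (Fintype.card ι : ℤ) ≠ 0 := by
    have : 0 < Fintype.card ι := Fintype.card_pos_iff.mpr ⟨r₀⟩
    exact_mod_cast this.ne'
  set R := univ.filter (fun k => π k ≠ k ∧ k < π k) with hRdef
  set C := univ.filter (fun j => κ j ≠ j ∧ j < κ j) with hCdef
  have hRC : R.card = C.card := by
    have h1 := two_mul_card_reps π hπinv
    have h2 := two_mul_card_reps κ hκinv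
    have hsR := Finset.card_filter_add_card_filter_not (s := (univ : Finset ι)) (fun i => π i = i)
    have hsC := Finset.card_filter_add_card_filter_not (s := (univ : Finset ι)) (fun j => κ j = j)
    have hfeq := card_fixed_eq_typeI hH hcard haut hr₀ hc₀
    have eR : (univ.filter fun i => π i ≠ i) = univ.filter (fun i => ¬ π i = i) := rfl
    have eC : (univ.filter fun j => κ j ≠ j) = univ.filter (fun j => ¬ κ j = j) := rfl
    rw [eR] at h1; rw [eC] at h2
    rw [hRdef, hCdef]; omega
  have hcardRC : Fintype.card {j // j ∈ C} = Fintype.card {k // k ∈ R} := by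
    rw [Fintype.card_coe, Fintype.card_coe, hRC]
  obtain ⟨σ⟩ : Nonempty ({j // j ∈ C} ≃ {k // k ∈ R}) := Fintype.card_eq.mp hcardRC
  set M : Matrix {k // k ∈ R} {k // k ∈ R} ℤ :=
    fun k l => H k.1 (σ.symm l).1 - d r₀ * e (σ.symm l).1 * H k.1 (κ (σ.symm l).1) with hMdef
  have hMM : M * Mᵀ = (Fintype.card ι : ℤ) • 1 := by
    ext k l
    have hk : π k.1 ≠ k.1 ∧ k.1 < π k.1 := (Finset.mem_filter.mp k.2).2
    have hl : π l.1 ≠ l.1 ∧ l.1 < π l.1 := (Finset.mem_filter.mp l.2).2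
    have hkl := invRep_row_orth hH haut hπinv hκinv hr₀ hk hl
    rw [Matrix.mul_apply, Matrix.smul_apply, smul_eq_mul, Matrix.one_apply]
    simp only [hMdef, Matrix.transpose_apply]
    rw [Equiv.sum_comp σ.symm (fun j : {j // j ∈ C} =>
      (H k.1 j.1 - d r₀ * e j.1 * H k.1 (κ j.1)) * (H l.1 j.1 - d r₀ * e j.1 * H l.1 (κ j.1)))]
    rw [Finset.sum_coe_sort C (fun j => (H k.1 j - d r₀ * e j * H k.1 (κ j)) * (H l.1 j - d r₀ * e j * H l.1 (κ j))),
      hCdef, hkl]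
    by_cases h : k = l
    · subst h; simp
    · have h' : k.1 ≠ l.1 := fun hh => h (Subtype.ext hh)
      rw [if_neg h', if_neg h, mul_zero]
  -- reindex along `{k // k ∈ R} ≃ Fin #R`
  let eR : {k // k ∈ R} ≃ Fin R.card := R.equivFin
  refine ⟨R.card, M.submatrix eR.symm eR.symm, two_mul_card_reps π hπinv, ?_⟩
  rw [transpose_submatrix, submatrix_mul_equiv, hMM, submatrix_smul, Pi.smul_apply, Pi.smul_apply,
    submatrix_one_equiv]

/-- **Type I forces `8 ∣ n − f` when `n` is not a sum of two squares** (ordered index type): the folding matrix lives on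
`t = (n − f)/2` coordinates with `M Mᵀ = n·1`; `t` is even (`involution_typeI_four_dvd_ord`, as `n` is then not a square) and
`t ≢ 2 (mod 4)` by `nat_sq_add_sq_of_int_mul_transpose_self`. -/
theorem involution_typeI_eight_dvd_ord (hH : IsHadamardMatrix H) (hns : ¬ ∃ x y : ℕ, Fintype.card ι = x ^ 2 + y ^ 2)
    (haut : IsSignedAut H π κ d e) (hπinv : ∀ i, π (π i) = i) (hκinv : ∀ j, κ (κ j) = j)
    {r₀ c₀ : ι} (hr₀ : π r₀ = r₀) (hc₀ : κ c₀ = c₀) :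
    8 ∣ (univ.filter fun i => π i ≠ i).card := by
  have hnsq : ¬ IsSquare (Fintype.card ι) := fun ⟨c, hc⟩ => hns ⟨c, 0, by rw [hc]; ring⟩
  have h4 := involution_typeI_four_dvd_ord hH hnsq haut hπinv hκinv hr₀ hc₀
  obtain ⟨t, M, h2t, hM⟩ := invRep_matrix_mul_transpose hH haut hπinv hκinv hr₀ hc₀
  by_contra h8
  have htmod : Fintype.card (Fin t) % 4 = 2 := by
    rw [Fintype.card_fin]; omega
  obtain ⟨x, y, hxy⟩ := nat_sq_add_sq_of_int_mul_transpose_self M (Fintype.card ι) hM htmod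
  exact hns ⟨x, y, hxy⟩

end weighing

section general
variable {H : Matrix ι ι ℤ} {π κ : Equiv.Perm ι} {d e : ι → ℤ}

/-- **Type I forces `8 ∣ n − f` when the order `n` is not a sum of two squares.**  For a Hadamard matrix of order `n = |ι|`
and a signed automorphism `(π, κ, d, e)` with `π² = κ² = 1` pointwise having a fixed row and a fixed column, the number of
moved rows is a multiple of `8`. -/
theorem involution_typeI_eight_dvd (hH : IsHadamardMatrix H) (hns : ¬ ∃ x y : ℕ, Fintype.card ι = x ^ 2 + y ^ 2)
    (haut : IsSignedAut H π κ d e) (hπinv : ∀ i, π (π i) = i) (hκinv : ∀ j, κ (κ j) = j)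
    (hr : ∃ i, π i = i) (hc : ∃ j, κ j = j) :
    8 ∣ (univ.filter fun i => π i ≠ i).card := by
  classical
  letI : LinearOrder ι := LinearOrder.lift' (Fintype.equivFin ι) (Fintype.equivFin ι).injective
  obtain ⟨r₀, hr₀⟩ := hr
  obtain ⟨c₀, hc₀⟩ := hc
  convert involution_typeI_eight_dvd_ord hH hns haut hπinv hκinv hr₀ hc₀ using 2

/-- `4q` with `q ≡ 3 (mod 4)` is not a sum of two natural squares (from `not_sum_two_sq_four_mul`) -/
theorem not_sq_add_sq_four_mul_nat {q : ℕ} (hq4 : q % 4 = 3) : ¬ ∃ x y : ℕ, 4 * q = x ^ 2 + y ^ 2 := by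
  rintro ⟨x, y, h⟩
  refine not_sum_two_sq_four_mul hq4 (x : ℤ) (y : ℤ) ?_
  exact_mod_cast h.symm

/-- **UNIFORM (order `4q`, `q ≡ 3 (mod 4)`): every type-I involution of a Hadamard matrix of order `4q` has `f ≡ 4 (mod 8)`
fixed rows** (`8 ∣ 4q − f` and `4q ≡ 4 (mod 8)`).  Applies to the open orders `668, 716, 892` (`q = 167, 179, 223`). -/
theorem hadamard4q_involution_typeI_mod8 {q : ℕ} (hq4 : q % 4 = 3) (hH : IsHadamardMatrix H)
    (hι : Fintype.card ι = 4 * q) (haut : IsSignedAut H π κ d e) (hπinv : ∀ i, π (π i) = i) (hκinv : ∀ j, κ (κ j) = j)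
    (hr : ∃ i, π i = i) (hc : ∃ j, κ j = j) :
    (univ.filter fun i => π i = i).card % 8 = 4 := by
  have hns : ¬ ∃ x y : ℕ, Fintype.card ι = x ^ 2 + y ^ 2 := by rw [hι]; exact not_sq_add_sq_four_mul_nat hq4
  have h8 := involution_typeI_eight_dvd hH hns haut hπinv hκinv hr hc
  have hsplit := Finset.card_filter_add_card_filter_not (s := (univ : Finset ι)) (fun i => π i = i)
  rw [Finset.card_univ, hι] at hsplit
  have eR : (univ.filter fun i => π i ≠ i) = univ.filter (fun i => ¬ π i = i) := rfl
  rw [eR] at h8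
  omega

/-- **H(668), type I: the number of fixed rows is `≡ 4 (mod 8)` and lies in `[4, 332]`** — `f ∈ {4, 12, 20, …, 332}`
(42 values), and equals the number of fixed columns. -/
theorem hadamard668_involution_typeI_mod8 (hH : IsHadamardMatrix H) (hι : Fintype.card ι = 668)
    (π κ : Equiv.Perm ι) (d e : ι → ℤ) (haut : IsSignedAut H π κ d e)
    (hπ : π ^ 2 = 1) (hκ : κ ^ 2 = 1) (hne : π ≠ 1 ∨ κ ≠ 1) (hr : ∃ i, π i = i) (hc : ∃ j, κ j = j) :
    (univ.filter fun i => π i = i).card % 8 = 4 ∧ 4 ≤ (univ.filter fun i => π i = i).card ∧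
      (univ.filter fun i => π i = i).card ≤ 332 ∧
      (univ.filter fun i => π i = i).card = (univ.filter fun j => κ j = j).card := by
  have hπinv : ∀ i, π (π i) = i := fun i => by
    have := congrArg (fun σ : Equiv.Perm ι => σ i) hπ; simpa [pow_two] using this
  have hκinv : ∀ j, κ (κ j) = j := fun j => by
    have := congrArg (fun σ : Equiv.Perm ι => σ j) hκ; simpa [pow_two] using this
  have h167 : (167 : ℕ) % 4 = 3 := by norm_num
  have hι' : Fintype.card ι = 4 * 167 := by rw [hι]
  have h8 := hadamard4q_involution_typeI_mod8 h167 hH hι' haut hπinv hκinv hr hc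
  obtain ⟨-, h4, h332, heq⟩ := hadamard668_involution_typeI_mod4 hH hι π κ d e haut hπ hκ hne hr hc
  exact ⟨h8, h4, h332, heq⟩

/-- **H(668) INVOLUTION CENSUS with the two-squares refinement.**  For a signed-permutation automorphism `(π, κ, d, e)` of a
Hadamard matrix of order `668` with `π² = κ² = 1` and `(π, κ) ≠ (1, 1)`: `π ≠ 1`, `κ ≠ 1`, and with `f_r = #Fix π`,
`f_c = #Fix κ` exactly one of — TYPE I: `f_r = f_c = f` with `f ≡ 4 (mod 8)`, `4 ≤ f ≤ 332`, all fixed rows and columns of one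
common sign `δ`; TYPE II: `{f_r, f_c} = {0, 4}` with the four fixed signs summing to `0`; TYPE III: `f_r = f_c = 0`. -/
theorem hadamard668_involution_census_mod8 (hH : IsHadamardMatrix H) (hι : Fintype.card ι = 668)
    (π κ : Equiv.Perm ι) (d e : ι → ℤ) (haut : IsSignedAut H π κ d e)
    (hπ : π ^ 2 = 1) (hκ : κ ^ 2 = 1) (hne : π ≠ 1 ∨ κ ≠ 1) :
    π ≠ 1 ∧ κ ≠ 1 ∧
    (((univ.filter fun i => π i = i).card = (univ.filter fun j => κ j = j).card ∧
        (univ.filter fun i => π i = i).card % 8 = 4 ∧ 4 ≤ (univ.filter fun i => π i = i).card ∧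
        (univ.filter fun i => π i = i).card ≤ 332 ∧
        ∃ δ : ℤ, (δ = 1 ∨ δ = -1) ∧ (∀ i, π i = i → d i = δ) ∧ (∀ j, κ j = j → e j = δ)) ∨
     ((univ.filter fun i => π i = i).card = 0 ∧ (univ.filter fun j => κ j = j).card = 4 ∧
        ∑ j ∈ univ.filter (fun j => κ j = j), e j = 0) ∨
     ((univ.filter fun i => π i = i).card = 4 ∧ (univ.filter fun j => κ j = j).card = 0 ∧
        ∑ i ∈ univ.filter (fun i => π i = i), d i = 0) ∨
     ((univ.filter fun i => π i = i).card = 0 ∧ (univ.filter fun j => κ j = j).card = 0)) := by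
  obtain ⟨hπ1, hκ1, hcases⟩ := hadamard668_involution_census hH hι π κ d e haut hπ hκ hne
  refine ⟨hπ1, hκ1, ?_⟩
  rcases hcases with ⟨heq, -, h2, h332, hδ⟩ | hII | hII' | hIII
  · -- type I: there is a fixed row and a fixed column
    have hr : ∃ i, π i = i := by
      have hpos : 0 < (univ.filter fun i => π i = i).card := by omega
      obtain ⟨i, hi⟩ := Finset.card_pos.mp hpos
      exact ⟨i, (Finset.mem_filter.mp hi).2⟩
    have hc : ∃ j, κ j = j := by
      have hpos : 0 < (univ.filter fun j => κ j = j).card := by omega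
      obtain ⟨j, hj⟩ := Finset.card_pos.mp hpos
      exact ⟨j, (Finset.mem_filter.mp hj).2⟩
    obtain ⟨h8, h4, -, -⟩ := hadamard668_involution_typeI_mod8 hH hι π κ d e haut hπ hκ hne hr hc
    exact Or.inl ⟨heq, h8, h4, h332, hδ⟩
  · exact Or.inr (Or.inl hII)
  · exact Or.inr (Or.inr (Or.inl hII'))
  · exact Or.inr (Or.inr (Or.inr hIII))

end general

end Summit.Ventures.DiscreteObjects.Hadamard
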